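import Literature.IUT.HodgeArakelov.AbsTopMonoidsGenuineZHatPow
import HarnessLib

/-!
# The power completion `Â = lim_n A/Aⁿ` of a commutative group and its natural `Ẑ^×`-action
# (carrier algebra for the GENUINE `(∗ĝp)` of [IUTchII] Example 1.8 (vii))

J. Neukirch, *Algebraic Number Theory*, Grundlehren 322 (Springer 1999), Ch. IV §2, Example 9 p. 274 (the profinite
completion `Ĝ = lim G/N`; `Ẑ = lim ℤ/nℤ`) and Exercise 1 p. 274 (the `Ẑ`-powers `σ ↦ σ^a` on a profinite group)
[cite: NeukirchANT1999, Ch. IV §2 p.274].  For an abelian group `A` whose quotients `A/Aⁿ` are finite (e.g. `A = k^×`,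
`k` a nonarchimedean local field, where the `(k^×)ⁿ` are moreover open and cofinal among open subgroups of finite
index) the profinite completion IS the power completion `Â := lim_n A/Aⁿ` (every finite-index subgroup of an abelian
group contains some `Aⁿ`); this file builds `Â` for ANY commutative group `A`, elementarily (compatible families in
`∏_n A/Aⁿ`, no category theory), with:

* `PowCompletion A` (a subgroup of `∏_{n ≥ 1} A/Aⁿ`, as a type), `PowCompletion.of : A →* Â` (`η`), `component n`,
  `of_eq_one_iff` (`η a = 1 ↔ a ∈ ⋂_n Aⁿ`) and **`of_injective`**: `η` is injective as soon as `⋂_n Aⁿ = 1` — abc-iut-L4's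
  `AbsTopIII.DivisibleElementsTrivial A` ([AbsTopIII] Def. 1.5 (a)), which the tree PROVES for the units of every
  finite extension of an MLF (`MLFClosure.divisibleElementsTrivial_units_of_finite`);
* functoriality `PowCompletion.map` (`map_of`, `map_id`, `map_comp`, `map_congr`);
* **the natural `Ẑ^×`-action** `PowCompletion.zhatPow A : Ẑ^× →* MulAut Â` — `u ∈ Ẑ^× = Aut(Ẑ)` (the tree's `ZHatUnits`)
  acts on the `n`-th component `A/Aⁿ` by `x ↦ x^{χ_n(u)}` (abc-iut-w6-d010's exponent systems `Genuine.levelExp u n`,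
  compatible and multiplicative: `levelExp_modEq` / `levelExp_mul`, over abc-iut-L5's `ZHatLevel.levelChar`); well defined
  because `A/Aᵐ` is killed by `m`; NATURAL in `A` (`map_zhatPow`).  This is the "natural action of `Ẑ^×`" on profinite
  completions that [IUTchII] Ex. 1.8 (vii) / Rmk. 1.11.1 (i) (c) invoke for `O^ĝp(G)`; no Kummer theory is needed to
  DEFINE it on the completion (contrast: on `𝒪_k̄^×` itself, `AbsTopMonoidsGenuineZHatPow`).

Used by `AbsTopMonoidsGenuineGhat.lean` (the genuine ind-profinite `O^ĝp(G) = lim→_J ((k̄^×)^J)^∧`; abc-iut cell, layer L6,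
row «GHATGP-GENUINE», L6-lead GO 2026-08-26T10:5xZ; seat abc-iut-L6-d2 gen 6).  Post-freeze def (reading (ii)).
HONEST FRAMING: classical algebra; nothing here bears on [IUTchIII] Cor. 3.12; typed ≠ proved elsewhere.
-/

noncomputable section

namespace Literature.IUT.HodgeArakelov

open Literature.AnabelianGeometry.AbsoluteAnabelian

universe u

namespace PowCompletion

variable (A : Type u) [CommGroup A]

/-- `Aⁿ ⊆ A`, the subgroup of `n`-th powers. [cite: NeukirchANT1999, Ch. IV §2 p.274] -/
def powSubgroup (n : ℕ+) : Subgroup A := (powMonoidHom (n : ℕ) : A →* A).range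

variable {A}

/-- `a ∈ Aⁿ ↔ ∃ b, bⁿ = a`. [cite: NeukirchANT1999, Ch. IV §2 p.274] -/
theorem mem_powSubgroup_iff {n : ℕ+} {a : A} : a ∈ powSubgroup A n ↔ ∃ b : A, b ^ (n : ℕ) = a := by
  simp [powSubgroup, MonoidHom.mem_range]

/-- `Aⁿ ⊆ Aᵐ` for `m ∣ n`. [cite: NeukirchANT1999, Ch. IV §2 p.274] -/
theorem powSubgroup_le_of_dvd {m n : ℕ+} (h : (m : ℕ) ∣ n) : powSubgroup A n ≤ powSubgroup A m := by
  intro a ha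
  obtain ⟨b, rfl⟩ := mem_powSubgroup_iff.mp ha
  obtain ⟨k, hk⟩ := h
  exact mem_powSubgroup_iff.mpr ⟨b ^ k, by rw [← pow_mul, mul_comm, ← hk]⟩

variable (A)

/-- The projection `A/Aⁿ → A/Aᵐ` for `m ∣ n`. [cite: NeukirchANT1999, Ch. IV §2 p.274] -/
def proj (m n : ℕ+) (h : (m : ℕ) ∣ n) : A ⧸ powSubgroup A n →* A ⧸ powSubgroup A m :=
  QuotientGroup.map (powSubgroup A n) (powSubgroup A m) (MonoidHom.id A)
    (fun a ha => by simpa using powSubgroup_le_of_dvd h ha)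

/-- The projection on representatives. [cite: NeukirchANT1999, Ch. IV §2 p.274] -/
@[simp] theorem proj_mk (m n : ℕ+) (h : (m : ℕ) ∣ n) (a : A) :
    proj A m n h (QuotientGroup.mk a) = QuotientGroup.mk a := rfl

/-- In `A/Aⁿ` every element has order dividing `n`. [cite: NeukirchANT1999, Ch. IV §2 p.274] -/
theorem pow_card_eq_one (n : ℕ+) (x : A ⧸ powSubgroup A n) : x ^ (n : ℕ) = 1 := by
  induction x using QuotientGroup.induction_on with
  | H a =>
    rw [← QuotientGroup.mk_pow, QuotientGroup.eq_one_iff]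
    exact mem_powSubgroup_iff.mpr ⟨a, rfl⟩

/-- Powers with congruent exponents agree on an element killed by the modulus. [cite: NeukirchANT1999, Ch. IV §2 p.274] -/
theorem pow_eq_pow_of_modEq {M : Type u} [Monoid M] {x : M} {n a b : ℕ} (hx : x ^ n = 1) (h : a ≡ b [MOD n]) :
    x ^ a = x ^ b := by
  rw [← Nat.mod_add_div a n, ← Nat.mod_add_div b n, pow_add, pow_add, pow_mul, pow_mul, hx, one_pow, one_pow,
    mul_one, mul_one, h]

/-- **The power completion `Â := lim_n A/Aⁿ`** of a commutative group `A` (compatible families), as a subgroup of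
`∏_n A/Aⁿ`; for `A = k^×`, `k` a nonarchimedean local field, this is the profinite completion of the topological
group `k^×` (the subgroups `(k^×)ⁿ` are open of finite index and cofinal). [cite: NeukirchANT1999, Ch. IV §2 p.274] -/
def carrier : Subgroup (∀ n : ℕ+, A ⧸ powSubgroup A n) where
  carrier := {x | ∀ (m n : ℕ+) (h : (m : ℕ) ∣ n), proj A m n h (x n) = x m}
  one_mem' := by intro m n h; simp
  mul_mem' := by
    intro x y hx hy m n h
    simp only [Pi.mul_apply, map_mul, hx m n h, hy m n h]
  inv_mem' := by
    intro x hx m n h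
    simp only [Pi.inv_apply, map_inv, hx m n h]

end PowCompletion

/-- `Â`, the power completion of `A` (the subgroup `PowCompletion.carrier A` as a type; a commutative group).
[cite: NeukirchANT1999, Ch. IV §2 p.274] -/
abbrev PowCompletion (A : Type u) [CommGroup A] : Type u := PowCompletion.carrier A

namespace PowCompletion

variable {A : Type u} [CommGroup A]

/-- The `n`-th component of an element of `Â`. [cite: NeukirchANT1999, Ch. IV §2 p.274] -/
def component (n : ℕ+) : PowCompletion A →* A ⧸ powSubgroup A n where
  toFun x := (x : carrier A).1 n
  map_one' := rfl
  map_mul' _ _ := rfl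

/-- The components of an element of `Â` are compatible. [cite: NeukirchANT1999, Ch. IV §2 p.274] -/
theorem component_compat (x : PowCompletion A) (m n : ℕ+) (h : (m : ℕ) ∣ n) :
    proj A m n h (component n x) = component m x :=
  (x : carrier A).2 m n h

/-- Elements of `Â` are determined by their components. [cite: NeukirchANT1999, Ch. IV §2 p.274] -/
@[ext] theorem ext {x y : PowCompletion A} (h : ∀ n, component n x = component n y) : x = y :=
  Subtype.ext (funext h)

/-- Build an element of `Â` from a compatible family. [cite: NeukirchANT1999, Ch. IV §2 p.274] -/
def mk (x : ∀ n : ℕ+, A ⧸ powSubgroup A n) (hx : ∀ (m n : ℕ+) (h : (m : ℕ) ∣ n), proj A m n h (x n) = x m) :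
    PowCompletion A := ⟨x, hx⟩

/-- Components of `mk`. [cite: NeukirchANT1999, Ch. IV §2 p.274] -/
@[simp] theorem component_mk (x : ∀ n : ℕ+, A ⧸ powSubgroup A n) (hx) (n : ℕ+) :
    component n (mk x hx) = x n := rfl

variable (A)

/-- The canonical map `η : A → Â`. [cite: NeukirchANT1999, Ch. IV §2 p.274] -/
def of : A →* PowCompletion A where
  toFun a := mk (fun _ => QuotientGroup.mk a) (fun m n h => rfl)
  map_one' := by ext n; rfl
  map_mul' a b := by ext n; rfl

variable {A}

/-- The `n`-th component of `η a` is the class of `a`. [cite: NeukirchANT1999, Ch. IV §2 p.274] -/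
@[simp] theorem component_of (n : ℕ+) (a : A) : component n (of A a) = QuotientGroup.mk a := rfl

/-- `η a = 1 ↔ a ∈ ⋂_n Aⁿ`. [cite: NeukirchANT1999, Ch. IV §2 p.274] -/
theorem of_eq_one_iff (a : A) : of A a = 1 ↔ ∀ n : ℕ+, ∃ b : A, b ^ (n : ℕ) = a := by
  constructor
  · intro h n
    have hn : component n (of A a) = 1 := by rw [h, map_one]
    rw [component_of, QuotientGroup.eq_one_iff] at hn
    exact mem_powSubgroup_iff.mp hn
  · intro h
    ext n
    rw [component_of, map_one, QuotientGroup.eq_one_iff]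
    exact mem_powSubgroup_iff.mpr (h n)

/-- `η : A → Â` is injective iff `⋂_n Aⁿ = 1` (`DivisibleElementsTrivial A`, [AbsTopIII] Def. 1.5 (a)).
[cite: NeukirchANT1999, Ch. IV §2 p.274] -/
theorem of_injective (hA : AbsTopIII.DivisibleElementsTrivial A) : Function.Injective (of A) := by
  intro a b hab
  have h1 : of A (a * b⁻¹) = 1 := by rw [map_mul, map_inv, hab, mul_inv_cancel]
  have h2 : a * b⁻¹ = 1 := hA.eq_one_of_forall_exists_pow _ fun n hn =>
    (of_eq_one_iff _).mp h1 ⟨n, hn⟩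
  rwa [mul_inv_eq_one] at h2

/-! ## Functoriality -/

variable {B : Type u} [CommGroup B] {D : Type u} [CommGroup D]

/-- `φ` on the `n`-th levels `A/Aⁿ → B/Bⁿ`. [cite: NeukirchANT1999, Ch. IV §2 p.274] -/
def mapLevel (φ : A →* B) (n : ℕ+) : A ⧸ powSubgroup A n →* B ⧸ powSubgroup B n :=
  QuotientGroup.map (powSubgroup A n) (powSubgroup B n) φ (fun a ha => by
    obtain ⟨c, rfl⟩ := mem_powSubgroup_iff.mp ha
    simpa using mem_powSubgroup_iff.mpr ⟨φ c, (map_pow φ c _).symm⟩)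

/-- `mapLevel` on representatives. [cite: NeukirchANT1999, Ch. IV §2 p.274] -/
@[simp] theorem mapLevel_mk (φ : A →* B) (n : ℕ+) (a : A) :
    mapLevel φ n (QuotientGroup.mk a) = QuotientGroup.mk (φ a) := rfl

/-- `mapLevel` is compatible with the projections. [cite: NeukirchANT1999, Ch. IV §2 p.274] -/
theorem proj_mapLevel (φ : A →* B) (m n : ℕ+) (h : (m : ℕ) ∣ n) (x : A ⧸ powSubgroup A n) :
    proj B m n h (mapLevel φ n x) = mapLevel φ m (proj A m n h x) := by
  induction x using QuotientGroup.induction_on with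
  | H a => rfl

/-- `φ̂ : Â → B̂` induced by `φ : A → B`. [cite: NeukirchANT1999, Ch. IV §2 p.274] -/
def map (φ : A →* B) : PowCompletion A →* PowCompletion B where
  toFun x := mk (fun n => mapLevel φ n (component n x)) (fun m n h => by
    rw [proj_mapLevel, component_compat])
  map_one' := by
    ext n
    simp only [component_mk, map_one]
  map_mul' x y := by
    ext n
    simp only [component_mk, map_mul]

/-- Components of `φ̂ x`. [cite: NeukirchANT1999, Ch. IV §2 p.274] -/
@[simp] theorem component_map (φ : A →* B) (x : PowCompletion A) (n : ℕ+) :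
    component n (map φ x) = mapLevel φ n (component n x) := rfl

/-- Components of `φ̂ x` on representatives. [cite: NeukirchANT1999, Ch. IV §2 p.274] -/
theorem component_map_mk (φ : A →* B) (x : PowCompletion A) (n : ℕ+) (a : A)
    (ha : component n x = QuotientGroup.mk a) : component n (map φ x) = QuotientGroup.mk (φ a) := by
  rw [component_map, ha, mapLevel_mk]

/-- `φ̂ ∘ η = η ∘ φ`. [cite: NeukirchANT1999, Ch. IV §2 p.274] -/
@[simp] theorem map_of (φ : A →* B) (a : A) : map φ (of A a) = of B (φ a) := by
  ext n
  rw [component_map_mk φ (of A a) n a rfl, component_of]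

/-- `(id)^ = id`. [cite: NeukirchANT1999, Ch. IV §2 p.274] -/
theorem map_id : map (MonoidHom.id A) = MonoidHom.id (PowCompletion A) := by
  ext x n
  obtain ⟨a, ha⟩ := QuotientGroup.mk_surjective (component n x)
  rw [component_map_mk _ x n a ha.symm, MonoidHom.id_apply, MonoidHom.id_apply, ha]

/-- `(ψ ∘ φ)^ = ψ̂ ∘ φ̂`. [cite: NeukirchANT1999, Ch. IV §2 p.274] -/
theorem map_comp (φ : A →* B) (ψ : B →* D) : map (ψ.comp φ) = (map ψ).comp (map φ) := by
  ext x n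
  obtain ⟨a, ha⟩ := QuotientGroup.mk_surjective (component n x)
  rw [component_map_mk _ x n a ha.symm, MonoidHom.comp_apply, MonoidHom.comp_apply,
    component_map_mk ψ (map φ x) n (φ a) (component_map_mk φ x n a ha.symm)]

/-- `map` depends only on the underlying function. [cite: NeukirchANT1999, Ch. IV §2 p.274] -/
theorem map_congr {φ ψ : A →* B} (h : ∀ a, φ a = ψ a) : map φ = map ψ := by
  ext x n
  obtain ⟨a, ha⟩ := QuotientGroup.mk_surjective (component n x)
  rw [component_map_mk _ x n a ha.symm, component_map_mk _ x n a ha.symm, h]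

/-! ## The natural `Ẑ^×`-action: `u` acts on `A/Aⁿ` by `x ↦ x^{χ_n(u)}` -/

open AbsTopMonoids.Genuine (levelExp levelExp_modEq levelExp_one levelExp_mul)

/-- The `u`-th power endomorphism of `Â`, `u ∈ Ẑ^× = Aut(Ẑ)`: on the `n`-th component `x ↦ x^{χ_n(u)}`
(well defined and compatible since `χ_n(u) ≡ χ_m(u) (mod m)` and `A/Aᵐ` is killed by `m`).
[cite: NeukirchANT1999, Ch. IV §2 p.274] -/
def zhatEnd (u : ZHatUnits) : PowCompletion A →* PowCompletion A where
  toFun x := mk (fun n => component n x ^ levelExp u n) (fun m n h => by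
    rw [map_pow, component_compat x m n h]
    exact pow_eq_pow_of_modEq (pow_card_eq_one A m _) (levelExp_modEq u m n m.pos n.pos h))
  map_one' := by ext n; simp
  map_mul' x y := by ext n; simp [mul_pow]

/-- Components of `x^u`. [cite: NeukirchANT1999, Ch. IV §2 p.274] -/
@[simp] theorem component_zhatEnd (u : ZHatUnits) (x : PowCompletion A) (n : ℕ+) :
    component n (zhatEnd u x) = component n x ^ levelExp u n := rfl

/-- `x^1 = x`. [cite: NeukirchANT1999, Ch. IV §2 p.274] -/
theorem zhatEnd_one : zhatEnd (A := A) 1 = MonoidHom.id _ := by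
  ext x n
  rw [component_zhatEnd, MonoidHom.id_apply, levelExp_one n.pos]
  conv_rhs => rw [← pow_one (component n x)]
  exact pow_eq_pow_of_modEq (pow_card_eq_one A n _) (Nat.mod_modEq 1 n)

/-- `x^{uv} = (x^v)^u`. [cite: NeukirchANT1999, Ch. IV §2 p.274] -/
theorem zhatEnd_mul (u v : ZHatUnits) : zhatEnd (A := A) (u * v) = (zhatEnd u).comp (zhatEnd v) := by
  ext x n
  rw [component_zhatEnd, MonoidHom.comp_apply, component_zhatEnd, component_zhatEnd, ← pow_mul,
    levelExp_mul u v n.pos, mul_comm (levelExp v n)]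
  exact pow_eq_pow_of_modEq (pow_card_eq_one A n _) (Nat.mod_modEq _ n)

variable (A)

/-- **The natural `Ẑ^×`-action on `Â`** as a homomorphism `Ẑ^× → Aut(Â)`. [cite: NeukirchANT1999, Ch. IV §2 p.274] -/
def zhatPow : ZHatUnits →* MulAut (PowCompletion A) where
  toFun u :=
    { toFun := zhatEnd u
      invFun := zhatEnd u⁻¹
      left_inv := fun x => by
        rw [← MonoidHom.comp_apply, ← zhatEnd_mul, inv_mul_cancel, zhatEnd_one, MonoidHom.id_apply]
      right_inv := fun x => by
        rw [← MonoidHom.comp_apply, ← zhatEnd_mul, mul_inv_cancel, zhatEnd_one, MonoidHom.id_apply]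
      map_mul' := map_mul (zhatEnd u) }
  map_one' := MulEquiv.ext fun x => by
    change zhatEnd 1 x = x
    rw [zhatEnd_one, MonoidHom.id_apply]
  map_mul' u v := MulEquiv.ext fun x => by
    change zhatEnd (u * v) x = zhatEnd u (zhatEnd v x)
    rw [zhatEnd_mul, MonoidHom.comp_apply]

variable {A}

/-- `zhatPow` applied. [cite: NeukirchANT1999, Ch. IV §2 p.274] -/
@[simp] theorem zhatPow_apply (u : ZHatUnits) (x : PowCompletion A) : zhatPow A u x = zhatEnd u x := rfl

/-- Components of `u · x`: `x_n^{χ_n(u)}`. [cite: NeukirchANT1999, Ch. IV §2 p.274] -/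
@[simp] theorem component_zhatPow (u : ZHatUnits) (x : PowCompletion A) (n : ℕ+) :
    component n (zhatPow A u x) = component n x ^ levelExp u n := rfl

/-- NATURALITY: the `Ẑ^×`-action commutes with every `φ̂`. [cite: NeukirchANT1999, Ch. IV §2 p.274] -/
theorem map_zhatPow (φ : A →* B) (u : ZHatUnits) (x : PowCompletion A) :
    map φ (zhatPow A u x) = zhatPow B u (map φ x) := by
  ext n
  obtain ⟨a, ha⟩ := QuotientGroup.mk_surjective (component n x)
  have h1 : component n (zhatPow A u x) = QuotientGroup.mk (a ^ levelExp u n) := by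
    rw [component_zhatPow, ← ha, QuotientGroup.mk_pow]
  rw [component_map_mk φ _ n _ h1, component_zhatPow, component_map_mk φ x n a ha.symm, map_pow,
    QuotientGroup.mk_pow]

/-- On `η(A)`: `u · η(a)` has `n`-th component `η(a^{χ_n(u)})`. [cite: NeukirchANT1999, Ch. IV §2 p.274] -/
theorem component_zhatPow_of (u : ZHatUnits) (a : A) (n : ℕ+) :
    component n (zhatPow A u (of A a)) = QuotientGroup.mk (a ^ levelExp u n) := by
  rw [component_zhatPow, component_of, QuotientGroup.mk_pow]

end PowCompletion

end Literature.IUT.HodgeArakelov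

end
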